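import Mathlib.Analysis.Fourier.AddCircleMulti
import Mathlib.Topology.MetricSpace.HolderNorm
import Mathlib.MeasureTheory.Integral.Bochner.ContinuousLinearMap
import Mathlib.MeasureTheory.SpecificCodomains.WithLp
import Literature.Analysis.FunctionSpaces.Complexify
import Literature.Analysis.FunctionSpaces.FlatTorus
import Literature.Analysis.FunctionSpaces.TorusCalculus
import Literature.Analysis.FunctionSpaces.TorusTestFunction
import HarnessLib

-- provenance: harness21/H21/H21/Prelude/Sobolev/TorusSobolevNorm.lean @ d6ac5b2 (interim HEAD d8f2665); M5 mechanical rewrite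
/-!
# Spectral Sobolev scale `H^s(T^d)`, function level (Sobolev trunk, C4)

This file defines the (inhomogeneous) Sobolev norms `‖f‖_{H^s}` of functions on the flat torus
`T^d = UnitAddTorus d`, spectrally, through Mathlib's Fourier coefficients
`UnitAddTorus.mFourierCoeff` (characters `e^{2πi k·x}`, `k : d → ℤ`):

  `‖f‖²_{H^s} = ∑_{k ∈ ℤ^d} ⟨k⟩^{2s} ‖f̂(k)‖²`, `⟨k⟩ = (1 + |k|²)^{1/2}`,

together with the membership predicate `Torus.MemSobolev s f` (`f ∈ H^s(T^d; F)`), the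
homogeneous seminorm `Torus.eHomSobolevSeminorm`, and the two time-dependent families used by the
fluid statements: `Torus.ContinuousInSobolevOn S s v` (`v ∈ C⁰_t(S; H^s_x)`) and
`Torus.MemL2Sobolev a b s v` (`v ∈ L²_t((a,b); H^s_x)`, Leray–Hopf energy class). This is
`sobolev_Hs_torus` part 1 of the outline `H21/Outlines/Sobolev.md`, §C4; the bundled Hilbert
space `H^s` is part 2 (C5).

## Mathlib

* `UnitAddTorus.mFourierCoeff` (`Mathlib/Analysis/Fourier/AddCircleMulti.lean`) needs a *complex*
  normed target `[NormedSpace ℂ F]`; so everything here is stated for complex normed targets `F`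
  (Hilbert targets for the Parseval-based lemmas, see below).
  **Real fields** enter through the isometric embeddings `Complex.ofRealLI` (scalars, Mathlib) and
  `Literature.Analysis.FunctionSpaces.EuclideanSpace.complexify` (vectors, `Literature.Prelude.Sobolev.Complexify`): use
  `f := (↑) ∘ θ`, resp. `f := complexify ∘ u`. The bridge lemmas
  `Torus.mFourierCoeff_complexify_apply`, `Torus.mFourierCoeff_ofReal_comp` identify these with the
  componentwise convention of the accepted `Literature.Analysis.FluidPDE.velocityFourierCoeff` (Statements/Turb/Wave0).
* Parseval on `T^d` is `UnitAddTorus.hasSum_sq_mFourierCoeff`; Mathlib has no Sobolev scale on the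
  torus. Its `ℝⁿ` Bessel-potential scale is `TemperedDistribution.MemSobolev`
  (`Mathlib/Analysis/Distribution/Sobolev.lean`), whose embedding computation
  `MemSobolev.fourier_memL1` is the `ℝⁿ` analogue of `Torus.MemSobolev.memHolder_of_lt` below.
* Hölder classes are Mathlib's `MemHolder` (`Mathlib/Topology/MetricSpace/HolderNorm.lean`).
* Completeness / Hilbert targets: `mFourierCoeff` itself needs no `[CompleteSpace F]`, so the
  definitions and the algebraic API are stated for a complex normed target `[NormedSpace ℂ F]`
  without it. The embeddings assume `[CompleteSpace F]` (for a non-complete target every Bochner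
  integral, hence every Fourier coefficient, is the junk `0`). The lemmas identifying the
  spectral norms with `L²`/derivative quantities (Parseval `H⁰ = L²`, `H¹` via gradients, `H^k`
  via weak derivatives) are stated for a *complete inner-product space*
  `[InnerProductSpace ℂ F] [CompleteSpace F]`, exactly as Mathlib does for `memSobolev_two_iff`
  and `MemSobolev.fourier_memL1` in `Mathlib/Analysis/Distribution/Sobolev.lean`: Parseval with
  values in a Banach space `F` holds iff `F` is (isomorphic to) a Hilbert space (Kwapień 1972),
  and for `F = ℂ × ℂ` with the sup norm the identities are false.
* Measure caveat (outline D2): `mFourierCoeff` is a Bochner integral against Mathlib's *local*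
  instance `volume := AddCircle.haarAddCircle`; H21 uses the global `volume`, which is equal to it
  (`Torus.volume_eq_pi_haarAddCircle`), so `Integrable f volume` below is the right guard.

## Conventions and junk values

* Characters are `e^{2πi k·x}`, weight `⟨k⟩^s = (1 + |k|²)^{s/2}`. Hence for smooth `f`,
  `‖∇f‖²_{L²} = 4π² ∑ |k|² ‖f̂(k)‖²` and `‖f‖²_{H¹} = ‖f‖²_{L²} + (4π²)⁻¹ ‖∇f‖²_{L²}`
  (`Torus.eSobolevNorm_one_sq_eq`): the spectral norms are *equivalent*, not equal, to the
  derivative-based ones.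
* **Junk note.** `mFourierCoeff f k` is a Bochner integral, hence `0` for non-integrable `f`, so
  `eSobolevNorm s f = 0` for such `f`; the norm functionals are meaningful only under
  `Integrable f volume` / `MemSobolev s f` (whose `Integrable` conjunct removes the junk). This note
  is repeated in every norm docstring.

## References

* L. Grafakos, *Classical Fourier Analysis*, 3rd ed. (2014), §3.1–3.3 (Fourier series on `T^n`).
  [Grafakos2014]
* H. Bahouri, J.-Y. Chemin, R. Danchin, *Fourier Analysis and Nonlinear PDEs* (2011), §1.3–1.4,
  §2.1 (Sobolev spaces `H^s`, embeddings). [BahouriCheminDanchinGL343]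
* R. Temam, *Navier–Stokes Equations and Nonlinear Functional Analysis*, 2nd ed. (1995), Ch. I
  §1–2 (`H^s_per`, energy spaces `L²(0,T; H¹)`). [TemamNSNFA1995]
* L. C. Evans, *Partial Differential Equations*, 2nd ed. (2010), §5.2, §5.6, §5.8.4
  (Fourier characterisation of `H^k`, Sobolev/Morrey embeddings). [Evans2010]
-/

open MeasureTheory Set Filter Topology UnitAddTorus
open scoped ENNReal NNReal

noncomputable section

namespace Literature.Analysis.FunctionSpaces

namespace Torus

variable {d : Type*} [Fintype d]
variable {F : Type*} [NormedAddCommGroup F]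

/-! ## Frequency weights -/

section Weight

/-- The squared Euclidean length `|k|² = ∑ᵢ kᵢ²` of a frequency `k ∈ ℤ^d`
(Grafakos, *Classical Fourier Analysis*, §3.1). [folklore] -/
def freqNormSq (k : d → ℤ) : ℝ := ∑ i, (k i : ℝ) ^ 2

/-- `|k|² ≥ 0`. [folklore] -/
theorem freqNormSq_nonneg (k : d → ℤ) : 0 ≤ freqNormSq k :=
  Finset.sum_nonneg fun i _ => sq_nonneg (k i : ℝ)

/-- `|0|² = 0`. [folklore] -/
@[simp]
theorem freqNormSq_zero : freqNormSq (0 : d → ℤ) = 0 := by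
  simp [freqNormSq]

/-- `|-k|² = |k|²`. [folklore] -/
@[simp]
theorem freqNormSq_neg (k : d → ℤ) : freqNormSq (-k) = freqNormSq k := by
  simp [freqNormSq]

/-- The Japanese bracket weight `⟨k⟩^s = (1 + |k|²)^{s/2}` of order `s ∈ ℝ` at the frequency
`k ∈ ℤ^d` (Bahouri–Chemin–Danchin, Def. 1.3.4 adapted to `T^d`; Grafakos, §3.3). [folklore] -/
def sobolevWeight (s : ℝ) (k : d → ℤ) : ℝ := (1 + freqNormSq k) ^ (s / 2)

/-- `⟨k⟩⁰ = 1`. [folklore] -/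
@[simp]
theorem sobolevWeight_zero (k : d → ℤ) : sobolevWeight 0 k = 1 := by
  simp [sobolevWeight]

/-- `⟨k⟩^s > 0`. [folklore] -/
theorem sobolevWeight_pos (s : ℝ) (k : d → ℤ) : 0 < sobolevWeight s k :=
  Real.rpow_pos_of_pos (by linarith [freqNormSq_nonneg k]) _

/-- `⟨0⟩^s = 1` (the zero mode carries weight one for every `s`). [folklore] -/
@[simp]
theorem sobolevWeight_apply_zero (s : ℝ) : sobolevWeight s (0 : d → ℤ) = 1 := by
  simp [sobolevWeight]

/-- `⟨k⟩^{-s} ⟨k⟩^{s} = 1`: the weights of `H^{-s}` and `H^s` are inverse to each other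
(duality `H^{-s} = (H^s)'`, Bahouri–Chemin–Danchin, Prop. 1.3.6 remark). [folklore] -/
@[simp]
theorem sobolevWeight_neg_mul_sobolevWeight (s : ℝ) (k : d → ℤ) :
    sobolevWeight (-s) k * sobolevWeight s k = 1 := by
  have h : 0 < 1 + freqNormSq k := by linarith [freqNormSq_nonneg k]
  rw [sobolevWeight, sobolevWeight, ← Real.rpow_add h, show -s / 2 + s / 2 = 0 by ring,
    Real.rpow_zero]

/-- The weights are monotone in the order: `⟨k⟩^{s'} ≤ ⟨k⟩^{s}` for `s' ≤ s` (since `⟨k⟩ ≥ 1`);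
this is the inclusion `H^s ⊆ H^{s'}` at the level of weights. [folklore] -/
theorem sobolevWeight_mono {s s' : ℝ} (h : s' ≤ s) (k : d → ℤ) :
    sobolevWeight s' k ≤ sobolevWeight s k :=
  Real.rpow_le_rpow_of_exponent_le (by linarith [freqNormSq_nonneg k]) (by linarith)

end Weight

/-! ## Sobolev norms and the predicate `MemSobolev` -/

section Norm

variable [NormedSpace ℂ F]

/-- The extended `H^s(T^d)` norm of `f : T^d → F`,
`‖f‖_{H^s} = (∑_{k ∈ ℤ^d} ⟨k⟩^{2s} ‖f̂(k)‖²)^{1/2} ∈ [0, ∞]`, where `f̂(k) = mFourierCoeff f k`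
(Grafakos, §3.3; Bahouri–Chemin–Danchin, Def. 1.3.4 on `T^d`; Temam, Ch. I §2, `H^s_per`).
**Junk note:** `mFourierCoeff f k` is a Bochner integral, hence `0` for non-integrable `f`, so
`eSobolevNorm s f = 0` for such `f`; the functional is meaningful only under `Integrable f volume`
/ `MemSobolev s f` (whose `Integrable` conjunct removes the junk). [folklore] -/
def eSobolevNorm (s : ℝ) (f : UnitAddTorus d → F) : ℝ≥0∞ :=
  (∑' k : d → ℤ, ENNReal.ofReal (sobolevWeight s k ^ 2) * ‖mFourierCoeff f k‖ₑ ^ 2) ^ (1 / 2 : ℝ)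

/-- The real-valued `H^s(T^d)` norm `‖f‖_{H^s} = (eSobolevNorm s f).toReal` (junk value `0` when
the extended norm is `∞`) (Grafakos, §3.3; Temam, Ch. I §2).
**Junk note:** `mFourierCoeff f k` is a Bochner integral, hence `0` for non-integrable `f`, so
`sobolevNorm s f = 0` for such `f`; the functional is meaningful only under `Integrable f volume`
/ `MemSobolev s f` (whose `Integrable` conjunct removes the junk). [folklore] -/
def sobolevNorm (s : ℝ) (f : UnitAddTorus d → F) : ℝ :=
  (eSobolevNorm s f).toReal

/-- The extended homogeneous `Ḣ^s(T^d)` seminorm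
`|f|_{Ḣ^s} = (∑_{k ≠ 0} |k|^{2s} ‖f̂(k)‖²)^{1/2} ∈ [0, ∞]`; the zero mode is omitted (its term is
set to `0`, so that negative `s` make sense) (Bahouri–Chemin–Danchin, §1.4 adapted to `T^d`;
Grafakos, §3.3).
**Junk note:** `mFourierCoeff f k` is a Bochner integral, hence `0` for non-integrable `f`, so
`eHomSobolevSeminorm s f = 0` for such `f`; the functional is meaningful only under
`Integrable f volume` / `MemSobolev s f` (whose `Integrable` conjunct removes the junk). [folklore] -/
def eHomSobolevSeminorm (s : ℝ) (f : UnitAddTorus d → F) : ℝ≥0∞ :=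
  (∑' k : d → ℤ, (if k = 0 then 0 else ENNReal.ofReal (freqNormSq k ^ s)) *
    ‖mFourierCoeff f k‖ₑ ^ 2) ^ (1 / 2 : ℝ)

/-- Membership in the Sobolev space `H^s(T^d; F)`: `f` is integrable (so that its Fourier
coefficients are genuine) and `‖f‖_{H^s} < ∞` (Grafakos, §3.3; Temam, Ch. I §2, `H^s_per`).
The `Integrable` conjunct removes the junk value of `eSobolevNorm` on non-integrable functions;
for `s ≥ 0` it is automatic from `‖f‖_{H^s} < ∞` + Parseval, for `s < 0` it restricts to
`H^s ∩ L¹` (genuine distributions of negative order are not functions and are out of scope of the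
function-level predicate). [folklore] -/
def MemSobolev (s : ℝ) (f : UnitAddTorus d → F) : Prop :=
  Integrable f volume ∧ eSobolevNorm s f < ∞

/-- An `H^s` function is integrable (first conjunct of the definition). [folklore] -/
theorem MemSobolev.integrable {s : ℝ} {f : UnitAddTorus d → F} (hf : MemSobolev s f) :
    Integrable f volume :=
  hf.1

/-- An `H^s` function has finite `H^s` norm (second conjunct of the definition). [folklore] -/
theorem MemSobolev.eSobolevNorm_lt_top {s : ℝ} {f : UnitAddTorus d → F} (hf : MemSobolev s f) :
    eSobolevNorm s f < ∞ :=
  hf.2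

/-- The zero function has zero `H^s` norm. [folklore] -/
@[simp]
theorem eSobolevNorm_zero_fun (s : ℝ) : eSobolevNorm s (0 : UnitAddTorus d → F) = 0 := by
  have h : ∀ k : d → ℤ, mFourierCoeff (0 : UnitAddTorus d → F) k = 0 := fun k => by
    simp [mFourierCoeff]
  simp [eSobolevNorm, h]

/-- The zero function lies in every `H^s`. [folklore] -/
theorem memSobolev_zero_fun (s : ℝ) : MemSobolev s (0 : UnitAddTorus d → F) :=
  ⟨integrable_zero _ _ _, by simp⟩

/-- `‖-f‖_{H^s} = ‖f‖_{H^s}`. [folklore] -/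
@[simp]
theorem eSobolevNorm_neg (s : ℝ) (f : UnitAddTorus d → F) :
    eSobolevNorm s (-f) = eSobolevNorm s f := by
  have h : ∀ k : d → ℤ, mFourierCoeff (-f) k = -mFourierCoeff f k := fun k => by
    simp [mFourierCoeff, integral_neg]
  simp [eSobolevNorm, h]

/-- Monotonicity of the scale: `‖f‖_{H^{s'}} ≤ ‖f‖_{H^s}` for `s' ≤ s` (`⟨k⟩ ≥ 1`;
Bahouri–Chemin–Danchin, §1.3.1). [folklore] -/
theorem eSobolevNorm_mono {s s' : ℝ} (h : s' ≤ s) (f : UnitAddTorus d → F) :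
    eSobolevNorm s' f ≤ eSobolevNorm s f := by
  unfold eSobolevNorm
  gcongr with k
  · exact (sobolevWeight_pos s' k).le
  · exact sobolevWeight_mono h k

/-- `H^s ⊆ H^{s'}` for `s' ≤ s` (Bahouri–Chemin–Danchin, §1.3.1; Temam, Ch. I §2). [folklore] -/
theorem MemSobolev.mono {s s' : ℝ} {f : UnitAddTorus d → F} (hf : MemSobolev s f) (h : s' ≤ s) :
    MemSobolev s' f :=
  ⟨hf.1, (eSobolevNorm_mono h f).trans_lt hf.2⟩

/-- Triangle inequality: `‖f + g‖_{H^s} ≤ ‖f‖_{H^s} + ‖g‖_{H^s}` for integrable `f, g`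
(Minkowski in the weighted `ℓ²`; standard, cf. Grafakos, §3.3). Integrability is needed: otherwise
the Fourier coefficients of `f + g` need not be the sums of those of `f` and `g` (junk `0`).
[folklore] -/
def eSobolevNorm_add_le : Prop :=
  ∀ {s : ℝ} {f g : UnitAddTorus d → F} (hf : Integrable f volume) (hg : Integrable g volume),
    eSobolevNorm s (f + g) ≤ eSobolevNorm s f + eSobolevNorm s g

/-- Fourier coefficients are `ℂ`-linear: `𝓕(c • f)(k) = c • 𝓕f(k)` (no integrability needed). [folklore] -/
theorem mFourierCoeff_const_smul (c : ℂ) (f : UnitAddTorus d → F) (k : d → ℤ) :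
    mFourierCoeff (c • f) k = c • mFourierCoeff f k := by
  simp only [mFourierCoeff, Pi.smul_apply, smul_comm _ c, integral_smul]

/-- Homogeneity: `‖c • f‖_{H^s} = ‖c‖ ‖f‖_{H^s}` for `c ∈ ℂ`. [folklore] -/
theorem eSobolevNorm_const_smul {s : ℝ} (c : ℂ) (f : UnitAddTorus d → F) :
    eSobolevNorm s (c • f) = ‖c‖ₑ * eSobolevNorm s f := by
  unfold eSobolevNorm
  simp_rw [mFourierCoeff_const_smul, enorm_smul, mul_pow, mul_left_comm _ (‖c‖ₑ ^ 2),
    ENNReal.tsum_mul_left, ENNReal.mul_rpow_of_nonneg _ _ (by norm_num : (0 : ℝ) ≤ 1 / 2)]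
  congr 1
  rw [← ENNReal.rpow_natCast, ← ENNReal.rpow_mul]
  norm_num

/-- `H^s` is closed under addition (Grafakos, §3.3). [folklore] -/
def MemSobolev.add : Prop :=
  ∀ {s : ℝ} {f g : UnitAddTorus d → F} (hf : MemSobolev s f) (hg : MemSobolev s g),
    MemSobolev s (f + g)

/- interim proof relied on results that are now named facts (D-0014); demoted to a fact by the M5 import, proof preserved:
:=
  ⟨hf.1.add hg.1, (eSobolevNorm_add_le hf.1 hg.1).trans_lt (ENNReal.add_lt_top.2 ⟨hf.2, hg.2⟩)⟩
-/

/-- `H^s` is closed under negation. [folklore] -/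
theorem MemSobolev.neg {s : ℝ} {f : UnitAddTorus d → F} (hf : MemSobolev s f) :
    MemSobolev s (-f) :=
  ⟨hf.1.neg, by simpa using hf.2⟩

/-- `H^s` is closed under subtraction. [folklore] -/
def MemSobolev.sub : Prop :=
  ∀ {s : ℝ} {f g : UnitAddTorus d → F} (hf : MemSobolev s f) (hg : MemSobolev s g),
    MemSobolev s (f - g)

/- interim proof relied on results that are now named facts (D-0014); demoted to a fact by the M5 import, proof preserved:
:= by
  simpa [sub_eq_add_neg] using hf.add hg.neg
-/

/-- `H^s` is closed under complex scalar multiplication. [folklore] -/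
theorem MemSobolev.smul {s : ℝ} {f : UnitAddTorus d → F} (c : ℂ) (hf : MemSobolev s f) :
    MemSobolev s (c • f) :=
  ⟨hf.1.smul c, by
    rw [eSobolevNorm_const_smul]
    exact ENNReal.mul_lt_top (by simp) hf.2⟩

/-- `H^s` is closed under real scalar multiplication (real fields: `c • f` with `c : ℝ` acting
via the real structure of `F`, i.e. `c • f = (c : ℂ) • f`). [folklore] -/
theorem MemSobolev.real_smul {s : ℝ} {f : UnitAddTorus d → F} (c : ℝ) (hf : MemSobolev s f) :
    MemSobolev s (c • f) := by
  have : (c • f) = ((c : ℂ) • f) := by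
    ext x
    simp [Complex.coe_smul]
  rw [this]
  exact hf.smul (c : ℂ)

/-- Smooth functions lie in every `H^s`: `f̂(k)` decays faster than any power of `|k|`
(Grafakos 2014, Thm. 3.3.9 (a) / Cor. 3.3.10 (a):
`|f̂(m)| ≤ c_{n,s} max(‖f‖₁, ‖∂^α f‖₁)(1+|m|)^{-s}` for `f ∈ C^s(𝐓ⁿ)`, every `s`).
[cite: Grafakos2014, Thm. 3.3.9 (a) and Cor. 3.3.10 (a)] -/
def IsSmooth.memSobolev : Prop :=
  ∀ {f : UnitAddTorus d → F} (hf : IsSmooth f) (s : ℝ),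
    MemSobolev s f

end Norm

/-! ## `H⁰ = L²` (Parseval) -/

section L2

variable [InnerProductSpace ℂ F] [CompleteSpace F]

/-- `H⁰ = L²`: for every `f`, `MemSobolev 0 f ↔ MemLp f 2` (Parseval,
`UnitAddTorus.hasSum_sq_mFourierCoeff`, and uniqueness of Fourier coefficients of integrable
functions; Grafakos, Prop. 3.2.7). On the probability space `T^d`, `L² ⊆ L¹` supplies the
`Integrable` conjunct. Stated for a complete inner-product target `F` (Parseval fails for
general Banach targets; completeness excludes the vanishing of all Bochner integrals).
[cite: Grafakos2014, Prop. 3.2.7 (1) (Plancherel on 𝐓ⁿ)] -/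
def memSobolev_zero_iff : Prop :=
  ∀ {f : UnitAddTorus d → F},
    MemSobolev 0 f ↔ MemLp f 2 volume

/-- For integrable `f`, `‖f‖_{H⁰} = ‖f‖_{L²}` in `[0, ∞]` (Parseval; Grafakos, Prop. 3.2.7), for a
complete inner-product target `F`. The integrability hypothesis excludes the junk value `0` of
the left-hand side. [cite: Grafakos2014, Prop. 3.2.7 (1) (Plancherel on 𝐓ⁿ)] -/
def eSobolevNorm_zero_eq_eLpNorm : Prop :=
  ∀ {f : UnitAddTorus d → F} (hf : Integrable f volume),
    eSobolevNorm 0 f = eLpNorm f 2 volume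

/-- `H^s ⊆ L²` for `0 ≤ s` (Hilbert target). [folklore] -/
def MemSobolev.memLp_two : Prop :=
  ∀ {s : ℝ} {f : UnitAddTorus d → F} (hf : MemSobolev s f) (hs : 0 ≤ s),
    MemLp f 2 volume

/- interim proof relied on results that are now named facts (D-0014); demoted to a fact by the M5 import, proof preserved:
:=
  memSobolev_zero_iff.mp (hf.mono hs)
-/

end L2

/-! ## Time-dependent families: `C⁰_t H^s_x` and `L²_t H^s_x` -/

section Time

variable [NormedSpace ℂ F]

/-- `v ∈ C⁰(S; H^s(T^d))`: a time-dependent field `v : ℝ → T^d → F` is, on the time set `S`,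
pointwise in `H^s` and continuous in the `H^s` norm: for every `t₀ ∈ S`,
`‖v t - v t₀‖_{H^s} → 0` as `t → t₀` within `S` (Temam, Ch. III §1.1, spaces `C([0,T]; X)`;
Bahouri–Chemin–Danchin, §3.2). [folklore] -/
def ContinuousInSobolevOn (S : Set ℝ) (s : ℝ) (v : ℝ → UnitAddTorus d → F) : Prop :=
  (∀ t ∈ S, MemSobolev s (v t)) ∧
    ∀ t₀ ∈ S, Tendsto (fun t => eSobolevNorm s (v t - v t₀)) (𝓝[S] t₀) (𝓝 0)

/-- A `C⁰_t H^s_x` family is in `H^s` at each time of `S`. [folklore] -/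
theorem ContinuousInSobolevOn.memSobolev {S : Set ℝ} {s : ℝ} {v : ℝ → UnitAddTorus d → F}
    (hv : ContinuousInSobolevOn S s v) {t : ℝ} (ht : t ∈ S) : MemSobolev s (v t) :=
  hv.1 t ht

/-- Restriction of the time set preserves `C⁰_t H^s_x`. [folklore] -/
theorem ContinuousInSobolevOn.mono {S S' : Set ℝ} {s : ℝ} {v : ℝ → UnitAddTorus d → F}
    (hv : ContinuousInSobolevOn S s v) (h : S' ⊆ S) : ContinuousInSobolevOn S' s v :=
  ⟨fun t ht => hv.1 t (h ht), fun t₀ ht₀ => (hv.2 t₀ (h ht₀)).mono_left (nhdsWithin_mono _ h)⟩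

/-- The extended `L²(a, b; H^s(T^d))` norm of a time-dependent field,
`(∫_a^b ‖v t‖²_{H^s} dt)^{1/2} ∈ [0, ∞]` (Temam, Ch. III §1.1; the Leray–Hopf energy class is
`L^∞_t L²_x ∩ L²_t H¹_x`).
**Junk note:** `mFourierCoeff (v t) k` is a Bochner integral, hence `0` for non-integrable `v t`,
so the integrand `eSobolevNorm s (v t)` vanishes at such times; the functional is meaningful only
under the guarded predicate `MemL2Sobolev a b s v` (a.e. `MemSobolev s (v t)`). [folklore] -/
def eL2SobolevNorm (a b : ℝ) (s : ℝ) (v : ℝ → UnitAddTorus d → F) : ℝ≥0∞ :=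
  (∫⁻ t in Ioo a b, eSobolevNorm s (v t) ^ 2) ^ (1 / 2 : ℝ)

/-- `v ∈ L²(a, b; H^s(T^d))` (guarded): for a.e. `t ∈ (a, b)` the slice `v t` is a genuine `H^s`
function (in particular integrable, killing the junk of `eSobolevNorm`), and
`∫_a^b ‖v t‖²_{H^s} dt < ∞` (Temam, Ch. III §1.1 and Thm. 3.1: Leray–Hopf solutions lie in
`L²(0, T; V) ⊆ L²(0, T; H¹)`). Strong measurability in time is not demanded (v0 simplification,
harmless for the target statements, which only consume the two conjuncts). [folklore] -/
def MemL2Sobolev (a b : ℝ) (s : ℝ) (v : ℝ → UnitAddTorus d → F) : Prop :=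
  (∀ᵐ t ∂(volume.restrict (Ioo a b)), MemSobolev s (v t)) ∧ eL2SobolevNorm a b s v < ∞

/-- Continuous-in-time `H^s` families on `[a, b]` are square integrable in time with values in
`H^s` (`C([a,b]; X) ⊆ L²(a,b; X)`: a continuous function on a compact interval is bounded, hence
square integrable; standard, cf. Temam 1995, Ch. I §2). [folklore] -/
def ContinuousInSobolevOn.memL2Sobolev : Prop :=
  ∀ {a b : ℝ} {s : ℝ} {v : ℝ → UnitAddTorus d → F} (hv : ContinuousInSobolevOn (Icc a b) s v),
    MemL2Sobolev a b s v

end Time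

/-! ## Real fields: bridge to the componentwise convention -/

section Real

/-- Fourier coefficients of a complexified real vector field are computed componentwise:
`(𝓕(complexify ∘ u)(k))ᵢ = 𝓕(uᵢ)(k)`, where `uᵢ = fun x ↦ (u x i : ℂ)` (evaluation at `i` is a
continuous linear map and commutes with the Bochner integral, `MeasureTheory.eval_integral_piLp`;
Grafakos, §3.1). Integrability of `u` (w.r.t. the global `volume`, transported to Mathlib's local
`haarAddCircle` volume along `Torus.volume_eq_pi_haarAddCircle`) is what the interchange needs.
Hence, for integrable `u`, the accepted
`Literature.Turb.velocityFourierCoeff u k` (Statements/Turb/Wave0, defined componentwise) equals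
`mFourierCoeff (complexify ∘ u) k`. [folklore] -/
theorem mFourierCoeff_complexify_apply {u : UnitAddTorus d → EuclideanSpace ℝ d}
    (hu : Integrable u volume) (k : d → ℤ) (i : d) :
    (mFourierCoeff (EuclideanSpace.complexify ∘ u) k) i =
      mFourierCoeff (fun x => (u x i : ℂ)) k := by
  simp only [mFourierCoeff]
  -- transport integrability from the global `volume` to Mathlib's local `haarAddCircle` volume
  have hu' : Integrable u (Measure.pi fun _ : d => AddCircle.haarAddCircle) :=
    volume_eq_pi_haarAddCircle (d := d) ▸ hu
  rw [eval_integral_piLp]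
  · simp
  · intro j
    have hj : Integrable (fun x => (u x j : ℂ)) (Measure.pi fun _ : d => AddCircle.haarAddCircle) :=
      Complex.ofRealCLM.integrable_comp (hu'.eval_piLp j)
    refine (hj.bdd_mul (c := 1) (mFourier (-k)).continuous.aestronglyMeasurable ?_).congr ?_
    · exact Filter.Eventually.of_forall fun x =>
        ((mFourier (-k)).norm_coe_le_norm x).trans_eq mFourier_norm
    · exact Filter.Eventually.of_forall fun x => by simp

/-- Reality condition for complexified real scalar fields: `𝓕θ(-k) = conj (𝓕θ(k))` for
`θ : T^d → ℝ` viewed in `ℂ` via `(↑) = Complex.ofRealLI` (Grafakos, Prop. 3.2.6 (4)). No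
integrability hypothesis is needed (both sides are `0` otherwise). [folklore] -/
theorem mFourierCoeff_ofReal_comp (θ : UnitAddTorus d → ℝ) (k : d → ℤ) :
    mFourierCoeff (fun x => (θ x : ℂ)) (-k) =
      starRingEnd ℂ (mFourierCoeff (fun x => (θ x : ℂ)) k) := by
  simp only [mFourierCoeff, neg_neg, smul_eq_mul]
  rw [← integral_conj]
  congr 1 with x
  simp [mFourier_neg]

/-- Reality condition for complexified real vector fields, componentwise:
`(𝓕(complexify ∘ u)(-k))ᵢ = conj ((𝓕(complexify ∘ u)(k))ᵢ)` (Grafakos, Prop. 3.2.6 (4)). [folklore] -/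
theorem mFourierCoeff_complexify_neg_apply {u : UnitAddTorus d → EuclideanSpace ℝ d}
    (hu : Integrable u volume) (k : d → ℤ) (i : d) :
    (mFourierCoeff (EuclideanSpace.complexify ∘ u) (-k)) i =
      starRingEnd ℂ ((mFourierCoeff (EuclideanSpace.complexify ∘ u) k) i) := by
  rw [mFourierCoeff_complexify_apply hu, mFourierCoeff_complexify_apply hu,
    mFourierCoeff_ofReal_comp]

end Real

/-! ## Derivatives: `H¹` via gradients, `H^k` via weak derivatives, embeddings -/

section Deriv

variable [DecidableEq d] [InnerProductSpace ℂ F] [CompleteSpace F]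

/-- The `H¹` norm in terms of derivatives, for smooth `f`:
`‖f‖²_{H¹} = ‖f‖²_{L²} + (4π²)⁻¹ ‖∇f‖²_{L²}`, where `‖∇f‖²_{L²} = ∫ ∑ᵢ ‖∂ᵢ f‖²`. The factor
`(4π²)⁻¹` comes from the character convention `e^{2πi k·x}`: `𝓕(∂ᵢ f)(k) = 2πi kᵢ 𝓕f(k)`
(Grafakos 2014, §3.3, eq. (3.3.9), with Plancherel, Prop. 3.2.7 (1); Evans, §5.8.4, Thm. 8 for
`ℝⁿ`). Hilbert target `F` (Parseval). [cite: Grafakos2014, §3.3 eq. (3.3.9) with Prop. 3.2.7 (1)] -/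
def eSobolevNorm_one_sq_eq : Prop :=
  ∀ {f : UnitAddTorus d → F} (hf : IsSmooth f),
    eSobolevNorm 1 f ^ 2 =
      ENNReal.ofReal
        ((∫ x, ‖f x‖ ^ 2) + (4 * Real.pi ^ 2)⁻¹ * ∫ x, ∑ i, ‖partialDeriv i f x‖ ^ 2)

/-- Integer-order Sobolev spaces via weak derivatives, recursively:
`f ∈ H^{k+1}` iff `f ∈ H^k` and each weak partial derivative `∂ᵢ f` exists in `H^k`
(Fourier characterisation of `H^k`, Evans, §5.8.4, Thm. 8; Grafakos, §3.3; weak derivatives on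
`T^d` are `Torus.HasWeakPartialDeriv`). Hilbert target `F`: the forward direction is
Riesz–Fischer (the `ℓ²` sequence `2πi kᵢ f̂(k)` is the coefficient sequence of an `L²` function).
[cite: Evans2010, §5.8.4 Thm. 8 (Fourier characterization of H^k; ℝⁿ, torus analogue)] -/
def memSobolev_nat_iff_hasWeakPartialDeriv : Prop :=
  ∀ (k : ℕ) {f : UnitAddTorus d → F},
    MemSobolev ((k : ℝ) + 1) f ↔
      MemSobolev k f ∧
        ∀ i, ∃ g : UnitAddTorus d → F, HasWeakPartialDeriv i f g ∧ MemSobolev k g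

end Deriv

/-! ## Sobolev embeddings (statements) -/

section Embedding

variable [NormedSpace ℂ F] [CompleteSpace F]

/-- Sobolev embedding into Hölder classes on `T^d`: if `f ∈ H^s` and `d/2 + α < s` with
`α ≤ 1`, then `f` has an `α`-Hölder representative (Bahouri–Chemin–Danchin, Thm. 1.50 adapted to
`T^d`; Evans, §5.6.3, Thm. 6). Stated with an a.e. representative since `f` is only an
`L¹` function. The `ℝⁿ` computation behind it is Mathlib's `MemSobolev.fourier_memL1`
(`Mathlib/Analysis/Distribution/Sobolev.lean`).
[cite: BahouriCheminDanchinGL343, Thm. 1.50 (ℝ^d; adapted to 𝐓^d)] -/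
def MemSobolev.memHolder_of_lt : Prop :=
  ∀ {s : ℝ} {α : ℝ≥0} {f : UnitAddTorus d → F} (hf : MemSobolev s f) (hα : α ≤ 1) (hs : (Fintype.card d : ℝ) / 2 + α < s),
    ∃ g : UnitAddTorus d → F, g =ᵐ[volume] f ∧ MemHolder α g

/-- Sobolev embedding into continuous functions on `T^d`: if `f ∈ H^s` with `d/2 < s`, then
`f` has a continuous representative, since `∑ ‖f̂(k)‖ < ∞` by Cauchy–Schwarz against
`∑ (1+|k|²)^{-s} < ∞`, and functions with absolutely summable Fourier coefficients are continuous
(Grafakos 2014, §3.3.3, discussion after Def. 3.3.15: "functions in `A(𝐓ⁿ)` are continuous and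
bounded"; Bahouri–Chemin–Danchin, Thm. 1.50; the `ℝⁿ` analogue is Mathlib's
`MemSobolev.fourier_memL1`). [cite: Grafakos2014, §3.3.3 (after Def. 3.3.15) with Cauchy–Schwarz] -/
def MemSobolev.continuous_of_lt : Prop :=
  ∀ {s : ℝ} {f : UnitAddTorus d → F} (hf : MemSobolev s f) (hs : (Fintype.card d : ℝ) / 2 < s),
    ∃ g : UnitAddTorus d → F, g =ᵐ[volume] f ∧ Continuous g

end Embedding

end Torus

end Literature.Analysis.FunctionSpaces
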